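import Literature.Computability.AlgebraicComplexity.FSV18OccurUnitDifference
import Literature.Computability.AlgebraicComplexity.FSV18SparseHittingProofs
import HarnessLib

/-!
# The occur conjunct of FSV Thm. 9 (safe reading) from [ASSS16] §4 AS PRINTED — the bypass of
# `FSV2018_thm48` assembled (val-lit p1 g3; N1 occur push, lead-np RULINGS (31), (33))

Sources: Forbes–Shpilka–Volk, *Succinct hitting sets and barriers to proving lower bounds for
algebraic circuits*, ToC 14 (2018) / arXiv:1701.05328 §5.4 (Construction 46, Fact 47, Thm. 48,
Cor. 49; held `paper:arxiv-1701.05328` p0021) and §1.5 Thm. 9 (bib `ForbesShpilkaVolk2018`);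
Agrawal–Saha–Saptharishi–Saxena, *Jacobian hits circuits*, arXiv:1111.0582 §4 (held p0009–p0010;
bib `AgrawalEtAl2011`).

FSV Thm. 48 quotes [ASSS16]'s depth-`D` occur-`k` theorem in GENERATOR form for the whole class;
[ASSS16] prove the generator statement only after the top-fan-in reduction and reach the whole
class by the hitting-SET step `α ↦ α + e_i` (provenance B14/B21). The tree therefore types the
printed theorem as `FSV2018_thm48_topFanIn` (`FSV18OccurTopFanIn.lean`) and rebuilds FSV's route
around it; this file is the last link:

* §0 `isHittingSetGenerator_occurClass_of_le_one` — formulas of size `≤ 1` compute constants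
  (mutual structural recursion on FSV's Def. 45 model), so for `s ≤ 1` every map is a generator
  (the corner where the safe reading's clause `s^R < char` is void).
* §1 `isSuccinctGenerator_vdmGenCoeff` (the Vandermonde block is `roProductSums n r`-succinct, via
  Prop. 17 + Lemma 20), the seed budget `R!·s'^R ≤ 2^{R⌈log₂ s'⌉ + R⌈log₂ R⌉}` and two numeric
  lemmas.
* §2 `multilinearSPSHits_occurClass_of_thm48_topFanIn` — Thm. 9's occur bullet with EXPLICIT
  exponent `c(D,k)` and characteristic clause `char = 0 ∨ s^{4R+2D+1} < char`,
  `R = asssRTop (2k) (D+1) (2k)`, PROVED modulo `FSV2018_thm48_topFanIn`: the named fact at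
  parameters `(D+1, 2k, (s+2)², 2k)` with `Φ := G^{SV'}_{n,K}` (Cor. 34,
  `ForbesShpilkaVolk2018_svGeneratorHitsSparse_holds`), then the generator-form shift
  `ASSS16.isHittingSetGenerator_occurClass_of_topFanIn` (`FSV18OccurUnitDifference.lean`: one more
  SV block, the model lemma, the degree bound), then succinctness (Fact 47's argument for
  `Σ_ℓ Vandermonde_{r_ℓ} ⊕ G^{SV'}_{n,K+1}`) and Lemma 14 (`multilinearSPSHits_of_generator`);
  and `FSV2018_thm9_occur_safe_of_thm48_topFanIn` — the SAFE READING of `FSV2018_thm9_occur`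
  (RULING (33) STEP 2 text verbatim: `∀ D k, ∃ c R, …`) modulo the one named fact.

After STEP 2 (re-typing of `FSV2018_thm9_occur`), `FSV2018_thm9_occur_of_thm48_topFanIn` is
`FSV2018_thm9_occur_safe_of_thm48_topFanIn` by `exact`, and the N1 residual of the load-bearing
`FSV2018_thm9` becomes `{FSV2018_fact19, FSV2018_thm48_topFanIn}` ([SS13] rank bound; [ASSS16] §4
as printed — plan steps F2–F4), with `FSV2018_thm48` / `FSV2018_cor49` bypassed. Theorems only; no
definitions, no named facts. Honest framing: `VP ≠ VNP` is NOT proved and nothing here bears on it.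
-/

noncomputable section

namespace Literature.Computability.AlgebraicComplexity

open MvPolynomial Finset Literature.Barriers.ValiantsHypothesis

/-! ### §0 Tiny formulas compute constants (the corner `s ≤ 1`, where the characteristic clause
`s^R < char` of the safe reading carries no information) -/

section Constants

variable {F : Type*} [Field F] {ι : Type*}

/-- A leaf of FSV size `≤ 1` is a constant. [cite: ForbesShpilkaVolk2018, Def. 45 (seq.) = ToC Def. 5.21 (size of a leaf)] -/
theorem eq_C_of_leafSize_le_one (p : MvPolynomial ι F) (h : ∑ m ∈ p.support, (m.degree + 1) ≤ 1) :
    p = C (coeff 0 p) := by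
  refine totalDegree_eq_zero_iff_eq_C.1 (Nat.eq_zero_of_le_zero (Finset.sup_le fun m hm => ?_))
  have h1 := Finset.single_le_sum (f := fun m : ι →₀ ℕ => m.degree + 1) (fun _ _ => Nat.zero_le _) hm
  have h2 : (m.sum fun _ e => e) = m.degree := rfl
  rw [h2]
  omega

mutual
/-- An occur formula of size `≤ 1` computes a constant. [cite: ForbesShpilkaVolk2018, Def. 45 (seq.) = ToC Def. 5.21] -/
theorem OccurFormula.exists_eval_eq_C_of_size_le_one : ∀ φ : OccurFormula F ι,
    φ.size ≤ 1 → ∃ c : F, φ.eval = C c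
  | .leaf p => fun h => ⟨coeff 0 p, by
      simp only [OccurFormula.size] at h
      simp only [OccurFormula.eval]
      exact eq_C_of_leafSize_le_one p h⟩
  | .add as => fun h => by
      simp only [OccurFormula.size] at h
      simp only [OccurFormula.eval]
      exact OccurArgs.exists_evalSum_eq_C_of_size_le_one as (by omega)
  | .powProd ps => fun h => by
      simp only [OccurFormula.size] at h
      simp only [OccurFormula.eval]
      exact OccurPowArgs.exists_evalProd_eq_C_of_size_le_one ps h

/-- `+`-argument lists of size `≤ 1` sum to a constant. [cite: ForbesShpilkaVolk2018, Def. 45 (seq.) = ToC Def. 5.21] -/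
theorem OccurArgs.exists_evalSum_eq_C_of_size_le_one : ∀ as : OccurArgs F ι,
    as.size ≤ 1 → ∃ c : F, as.evalSum = C c
  | .nil => fun _ => ⟨0, by simp only [OccurArgs.evalSum, map_zero]⟩
  | .cons φ rest => fun h => by
      simp only [OccurArgs.size] at h
      obtain ⟨c₁, h₁⟩ := OccurFormula.exists_eval_eq_C_of_size_le_one φ (by omega)
      obtain ⟨c₂, h₂⟩ := OccurArgs.exists_evalSum_eq_C_of_size_le_one rest (by omega)
      exact ⟨c₁ + c₂, by simp only [OccurArgs.evalSum, h₁, h₂, map_add]⟩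

/-- `×⋏`-argument lists of size `≤ 1` multiply to a constant. [cite: ForbesShpilkaVolk2018, Def. 45 (seq.) = ToC Def. 5.21] -/
theorem OccurPowArgs.exists_evalProd_eq_C_of_size_le_one : ∀ ps : OccurPowArgs F ι,
    ps.size ≤ 1 → ∃ c : F, ps.evalProd = C c
  | .nil => fun _ => ⟨1, by simp only [OccurPowArgs.evalProd, map_one]⟩
  | .cons φ e rest => fun h => by
      simp only [OccurPowArgs.size] at h
      obtain ⟨c₁, h₁⟩ := OccurFormula.exists_eval_eq_C_of_size_le_one φ (by omega)
      obtain ⟨c₂, h₂⟩ := OccurPowArgs.exists_evalProd_eq_C_of_size_le_one rest (by omega)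
      exact ⟨c₁ ^ e * c₂, by simp only [OccurPowArgs.evalProd, h₁, h₂, map_mul, map_pow]⟩
end

/-- Members of `occurClass D k s` with `s ≤ 1` are constants. [cite: ForbesShpilkaVolk2018, Def. 45 and Cor. 49 (seq.) = ToC Def. 5.21, Cor. 5.25] -/
theorem exists_eq_C_of_mem_occurClass_of_le_one {D k s : ℕ} (hs : s ≤ 1) {f : MvPolynomial ι F}
    (hf : f ∈ occurClass F ι D k s) : ∃ c : F, f = C c := by
  obtain ⟨φ, rfl, -, -, hφ⟩ := hf
  exact OccurFormula.exists_eval_eq_C_of_size_le_one φ (hφ.trans hs)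

/-- For `s ≤ 1` every polynomial map is a hitting-set generator for `occurClass D k s`
(constants are fixed by `bind₁`). [cite: ForbesShpilkaVolk2018, Def. 7 and Cor. 49 (seq.) = ToC Def. 1.8, Cor. 5.25] -/
theorem isHittingSetGenerator_occurClass_of_le_one {n : ℕ} {τ : Type*}
    (G : multilinearMonomials n → MvPolynomial τ F) {D k s : ℕ} (hs : s ≤ 1) :
    IsHittingSetGenerator (occurClass F (multilinearMonomials n) D k s) G := by
  intro P hP hP0
  obtain ⟨c, rfl⟩ := exists_eq_C_of_mem_occurClass_of_le_one hs hP
  rw [bind₁_C_right, Ne, C_eq_zero]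
  rwa [Ne, C_eq_zero] at hP0

end Constants

/-! ### §1 Succinctness of the Vandermonde block and two numeric lemmas -/

section Succinct

variable {F : Type*} [Field F] {n : ℕ}

/-- The Vandermonde block `X_i ↦ Σ_j y_j t^{ij}` is `roProductSums n r`-succinct: its outputs are
outputs of the succinct rank condenser `G^{RC}_{n,r}` at the seeds `t_0 ↦ t`, `t_k ↦ t^{2^{k-1}}`
(Prop. 17, `bind₁_binaryPowersSubst_rcGenCoeff`) which is succinct (Lemma 20,
`isSuccinctGenerator_rcGenCoeff`). [cite: ForbesShpilkaVolk2018, Prop. 17 and Lemma 20 (seq.) = ToC Prop. 4.2 and Lemma 4.5, pp. 21–22] -/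
theorem isSuccinctGenerator_vdmGenCoeff (r : ℕ) :
    IsSuccinctGenerator (multilinearMonomials n) (roProductSums F n r)
      (fun m : multilinearMonomials n => vdmGenCoeff F n r (m : Fin n →₀ ℕ)) := by
  intro a
  obtain ⟨f, hf, hfa⟩ := isSuccinctGenerator_rcGenCoeff (F := F) (n := n) r
    (fun v => eval a (binaryPowersSubst F n r v))
  refine ⟨f, hf, ?_⟩
  rw [hfa]
  funext m
  simp only [genOutput_apply]
  rw [← bind₁_binaryPowersSubst_rcGenCoeff]
  exact (eval₂Hom_bind₁ _ _ _ _).symm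

/-- Seed budget of the SV block: `R!·s'^R ≤ 2^{R⌈log₂ s'⌉ + R⌈log₂ R⌉}`.
[cite: ForbesShpilkaVolk2018, Construction 46 and Cor. 49 (seq.) = ToC 5.22 / 5.25, pp. 29–30] -/
theorem factorial_mul_pow_le_two_pow_clog (R s' : ℕ) :
    R.factorial * s' ^ R ≤ 2 ^ (R * Nat.clog 2 s' + R * Nat.clog 2 R) :=
  calc R.factorial * s' ^ R
      ≤ (2 ^ Nat.clog 2 R) ^ R * (2 ^ Nat.clog 2 s') ^ R :=
        Nat.mul_le_mul
          ((Nat.factorial_le_pow _).trans (Nat.pow_le_pow_left (Nat.le_pow_clog one_lt_two _) _))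
          (Nat.pow_le_pow_left (Nat.le_pow_clog one_lt_two s') _)
    _ = 2 ^ (R * Nat.clog 2 s' + R * Nat.clog 2 R) := by
        rw [pow_add, pow_mul', pow_mul', mul_comm]

/-- `⌈log₂ (s+2)²⌉ ≤ 2⌈log₂ s⌉ + 4`. [folklore] -/
private theorem clog_two_sq_add_two_le (s : ℕ) : Nat.clog 2 ((s + 2) ^ 2) ≤ 2 * Nat.clog 2 s + 4 := by
  rw [Nat.clog_le_iff_le_pow one_lt_two]
  have h1 : s ≤ 2 ^ Nat.clog 2 s := Nat.le_pow_clog one_lt_two s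
  have h2 : 1 ≤ 2 ^ Nat.clog 2 s := Nat.one_le_two_pow
  have h3 : s + 2 ≤ 2 ^ (Nat.clog 2 s + 2) := by rw [pow_add]; omega
  calc (s + 2) ^ 2 ≤ (2 ^ (Nat.clog 2 s + 2)) ^ 2 := Nat.pow_le_pow_left h3 2
    _ = 2 ^ (2 * Nat.clog 2 s + 4) := by rw [← pow_mul]; ring_nf

/-- Absorbing a constant: `A · L² ≤ L^(A+2)` for `L ≥ 2`. [folklore] -/
private theorem mul_sq_le_pow_add_two {A L : ℕ} (hL : 2 ≤ L) : A * L ^ 2 ≤ L ^ (A + 2) := by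
  have hA : A ≤ 2 ^ A := Nat.lt_two_pow_self.le
  calc A * L ^ 2 ≤ 2 ^ A * L ^ 2 := Nat.mul_le_mul_right _ hA
    _ ≤ L ^ A * L ^ 2 := Nat.mul_le_mul_right _ (Nat.pow_le_pow_left hL A)
    _ = L ^ (A + 2) := by rw [← pow_add]

end Succinct


/-! ### §2 The occur conjunct of FSV Thm. 9 (safe reading) from [ASSS16] §4 AS PRINTED -/

/-- **FSV Thm. 9, occur-`k` bullet — explicit exponent and characteristic clause — PROVED modulo
`FSV2018_thm48_topFanIn`** ([ASSS16] §4 Thm. `dDkrPIT` as printed, bounded top fan-in), bypassing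
`FSV2018_thm48`/`FSV2018_cor49` as typed (provenance B14/B21; lead-np RULINGS (31), (33)). Route =
[ASSS16]'s own: the reduced class `occurClassTopFanIn (D+1) (2k) ((s+2)²) (2k)` is hit by
`Σ_ℓ Vandermonde_{r_ℓ} ⊕ G^{SV'}_{n,K}` (the named fact, with `Φ :=` the SV block, which hits
sparsity `R!·((s+2)²)^R ≤ 2^K` by Cor. 34 `ForbesShpilkaVolk2018_svGeneratorHitsSparse_holds`,
`K = R⌈log₂(s+2)²⌉ + R⌈log₂ R⌉`, `R = asssRTop (2k) (D+1) (2k)`); one more SV block supplies the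
shift `α + e_i` (`ASSS16.isHittingSetGenerator_occurClass_of_topFanIn`: the unit differences of
`occurClass D k s` lie in the reduced class, and have degree `≤ (s+1)^D < char`); the outputs are
read-once affine product sums of top fan-in `(D−1)R + K + 2` (`isSuccinctGenerator_vdmGenCoeff`,
`isSuccinctGenerator_svGenCoeff`), whence multilinear `ΣΠΣ` formulas of size
`(⌈log₂ s⌉ + n + 2)^c`, `c = DR + 6R + R⌈log₂ R⌉ + 4`, by Lemma 14
(`multilinearSPSHits_of_generator`). Characteristic: `char = 0` or `char > s^{4R + 2D + 1}`
(which dominates `((s+2)²)^R` and `(s+1)^D` for `s ≥ 2`); for `s ≤ 1` the class consists of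
constants (`isHittingSetGenerator_occurClass_of_le_one`) and no hypothesis is used.
[cite: AgrawalEtAl2011, §4 (Thm. dDkrPIT and ¶1); ForbesShpilkaVolk2018, Thm. 9, Cor. 34, Construction 46, Cor. 49 (seq.) = ToC Thm. 1.10, Cor. 5.10, 5.22, 5.25]
locator: paper:arxiv-1111.0582 p0009.txt:L3–L24, p0010.txt:L40–L62; paper:arxiv-1701.05328 p0021.txt:L11–L45 -/
theorem multilinearSPSHits_occurClass_of_thm48_topFanIn (h : FSV2018_thm48_topFanIn) (D k : ℕ) :
    ∀ (F : Type) [Field F] [Infinite F] (n s : ℕ),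
      (ringChar F = 0 ∨ s ^ (4 * asssRTop (2 * k) (D + 1) (2 * k) + 2 * D + 1) < ringChar F) →
        MultilinearSPSHits F n
          ((Nat.clog 2 s + n + 2) ^
            (D * asssRTop (2 * k) (D + 1) (2 * k) + 4 * asssRTop (2 * k) (D + 1) (2 * k) +
              asssRTop (2 * k) (D + 1) (2 * k) * Nat.clog 2 (asssRTop (2 * k) (D + 1) (2 * k)) + 2 +
              2 * asssRTop (2 * k) (D + 1) (2 * k) + 2))
          (occurClass F (multilinearMonomials n) D k s) := by
  intro F _ _ n s hchar
  set R := asssRTop (2 * k) (D + 1) (2 * k) with hR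
  set K := R * Nat.clog 2 ((s + 2) ^ 2) + R * Nat.clog 2 R with hK
  set L := Nat.clog 2 s + n + 2 with hL
  -- seed slots of the Vandermonde blocks (layout of `FSV2018_thm48` / `FSV2018_thm48_topFanIn`)
  let slot : (r : Fin (D + 1 - 2) → Fin (R + 1)) → (ℓ : Fin (D + 1 - 2)) → Fin (r ℓ) ⊕ Unit →
      Fin (D + 1 - 2) × (Fin R ⊕ Unit) :=
    fun r ℓ v => (ℓ, Sum.map (Fin.castLE (Nat.lt_succ_iff.mp (r ℓ).isLt)) id v)
  -- the Vandermonde part and the whole generator `Σ_ℓ Vdm_{r ℓ} ⊕ SV_{K+1}`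
  let G : (r : Fin (D + 1 - 2) → Fin (R + 1)) → multilinearMonomials n →
      MvPolynomial (Fin (D + 1 - 2) × (Fin R ⊕ Unit)) F :=
    fun r m => ∑ ℓ : Fin (D + 1 - 2), rename (slot r ℓ) (vdmGenCoeff F n (r ℓ) (m : Fin n →₀ ℕ))
  let Γ : (r : Fin (D + 1 - 2) → Fin (R + 1)) → multilinearMonomials n →
      MvPolynomial ((Fin (D + 1 - 2) × (Fin R ⊕ Unit)) ⊕ (Fin (K + 1) ⊕ (Fin (K + 1) × Fin n))) F :=
    fun r m => rename Sum.inl (G r m) + rename Sum.inr (svGenCoeff F n (K + 1) (m : Fin n →₀ ℕ))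
  -- (1) succinctness, for every choice of block sizes (Fact 47's argument)
  have hsucc : ∀ r, IsSuccinctGenerator (multilinearMonomials n)
      (roProductSums F n ((D + 1 - 2) * R + (K + 1 + 1))) (Γ r) := by
    intro r a
    choose f hf hfa using fun ℓ : Fin (D + 1 - 2) =>
      isSuccinctGenerator_vdmGenCoeff (F := F) (n := n) (r ℓ) (fun v => a (Sum.inl (slot r ℓ v)))
    obtain ⟨g, hg, hga⟩ :=
      isSuccinctGenerator_svGenCoeff (F := F) (n := n) (K + 1) (fun v => a (Sum.inr v))
    refine ⟨(∑ ℓ, f ℓ) + g, add_mem_roProductSums (sum_mem_roProductSums f fun ℓ =>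
      roProductSums_mono (Nat.lt_succ_iff.mp (r ℓ).isLt) (hf ℓ)) hg, ?_⟩
    funext m
    have h2 := congrFun hga m
    simp only [coeffVector_apply, genOutput_apply] at h2 ⊢
    rw [coeff_add, coeff_sum, h2]
    show _ = eval a (rename Sum.inl (G r m) +
      rename Sum.inr (svGenCoeff F n (K + 1) (m : Fin n →₀ ℕ)))
    rw [map_add, eval_rename, eval_rename]
    congr 1
    show _ = eval (a ∘ Sum.inl)
      (∑ ℓ : Fin (D + 1 - 2), rename (slot r ℓ) (vdmGenCoeff F n (r ℓ) (m : Fin n →₀ ℕ)))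
    rw [map_sum]
    refine Finset.sum_congr rfl fun ℓ _ => ?_
    have h1 := congrFun (hfa ℓ) m
    simp only [coeffVector_apply, genOutput_apply] at h1
    rw [h1, eval_rename]
    rfl
  -- (2) the size bound `((D-1)R + K + 2)(n + 2) ≤ L^c`
  have hL2 : 2 ≤ L := by omega
  have hKS : ((D + 1 - 2) * R + (K + 1 + 1)) * (n + 2) ≤
      L ^ (D * R + 4 * R + R * Nat.clog 2 R + 2 + 2 * R + 2) := by
    have hcl := clog_two_sq_add_two_le s
    have h1 : (D + 1 - 2) * R ≤ D * R := Nat.mul_le_mul_right _ (by omega)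
    have h2 : R * Nat.clog 2 ((s + 2) ^ 2) ≤ R * (2 * Nat.clog 2 s + 4) := Nat.mul_le_mul_left _ hcl
    have h3 : R * Nat.clog 2 s ≤ R * L := Nat.mul_le_mul_left _ (by omega)
    have hT : (D + 1 - 2) * R + (K + 1 + 1) ≤
        (D * R + 4 * R + R * Nat.clog 2 R + 2) + 2 * R * L := by
      rw [hK]; nlinarith [h1, h2, h3]
    calc ((D + 1 - 2) * R + (K + 1 + 1)) * (n + 2)
        ≤ ((D * R + 4 * R + R * Nat.clog 2 R + 2) + 2 * R * L) * L := Nat.mul_le_mul hT (by omega)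
      _ ≤ ((D * R + 4 * R + R * Nat.clog 2 R + 2) * L + 2 * R * L) * L := by
          refine Nat.mul_le_mul_right _ (Nat.add_le_add_right ?_ _)
          exact Nat.le_mul_of_pos_right _ (by omega)
      _ = (D * R + 4 * R + R * Nat.clog 2 R + 2 + 2 * R) * L ^ 2 := by ring
      _ ≤ L ^ (D * R + 4 * R + R * Nat.clog 2 R + 2 + 2 * R + 2) := mul_sq_le_pow_add_two hL2
  -- (3) the hitting property, for some choice of block sizes
  obtain ⟨r, hgen⟩ : ∃ r, IsHittingSetGenerator (occurClass F (multilinearMonomials n) D k s) (Γ r) := by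
    by_cases hs2 : 2 ≤ s
    · -- characteristic bookkeeping: `s^(4R+2D+1)` dominates `((s+2)²)^R` and `(s+1)^D`
      have hs1 : 1 ≤ s := by omega
      have h4 : 4 ≤ s ^ 2 := by have := Nat.mul_le_mul hs2 hs2; simpa [sq] using this
      have h5 : 4 * s ≤ 2 * s ^ 2 :=
        calc 4 * s = 2 * s * 2 := by ring
          _ ≤ 2 * s * s := Nat.mul_le_mul_left _ hs2
          _ = 2 * s ^ 2 := by ring
      have h6 : 4 * s ^ 2 ≤ s ^ 4 :=
        calc 4 * s ^ 2 ≤ s ^ 2 * s ^ 2 := Nat.mul_le_mul_right _ h4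
          _ = s ^ 4 := by ring
      have hsq : (s + 2) ^ 2 ≤ s ^ 4 := by
        have e1 : (s + 2) ^ 2 = s ^ 2 + 4 * s + 4 := by ring
        omega
      have hs1' : s + 1 ≤ s ^ 2 := by
        have := Nat.mul_le_mul_right s hs2
        rw [sq]; omega
      have hcharF1 : ringChar F = 0 ∨ ((s + 2) ^ 2) ^ R < ringChar F := by
        refine hchar.imp id fun hc => lt_of_le_of_lt ?_ hc
        calc ((s + 2) ^ 2) ^ R ≤ (s ^ 4) ^ R := Nat.pow_le_pow_left hsq R
          _ = s ^ (4 * R) := by rw [← pow_mul]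
          _ ≤ s ^ (4 * R + 2 * D + 1) := Nat.pow_le_pow_right hs1 (by omega)
      have hcharD : ringChar F = 0 ∨ (s + 1) ^ D < ringChar F := by
        refine hchar.imp id fun hc => lt_of_le_of_lt ?_ hc
        calc (s + 1) ^ D ≤ (s ^ 2) ^ D := Nat.pow_le_pow_left hs1' D
          _ = s ^ (2 * D) := by rw [← pow_mul]
          _ ≤ s ^ (4 * R + 2 * D + 1) := Nat.pow_le_pow_right hs1 (by omega)
      -- the SV block hits sparsity `R!·((s+2)²)^R` (Cor. 34)
      have hΦ : IsHittingSetGenerator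
          {P : MvPolynomial (multilinearMonomials n) F |
            P.support.card ≤ R.factorial * ((s + 2) ^ 2) ^ R}
          (fun m : multilinearMonomials n => svGenCoeff F n K (m : Fin n →₀ ℕ)) := by
        intro P hP hP0
        exact ForbesShpilkaVolk2018_svGeneratorHitsSparse_holds F n K P hP0
          (hP.trans (by rw [hK]; exact factorial_mul_pow_le_two_pow_clog R _))
      obtain ⟨r, hr⟩ := h F n (D + 1) (2 * k) ((s + 2) ^ 2) (2 * k) _ _ hcharF1 hΦ
      refine ⟨r, ASSS16.isHittingSetGenerator_occurClass_of_topFanIn K D k s (G r) hcharD ?_⟩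
      -- the named fact's generator is `rename inl ∘ G r ⊕ rename inr ∘ SV_K`
      convert hr using 2 with m
      show rename Sum.inl (∑ ℓ : Fin (D + 1 - 2), rename (slot r ℓ)
        (vdmGenCoeff F n (r ℓ) (m : Fin n →₀ ℕ))) + _ = _
      rw [map_sum]
      congr 1
      refine Finset.sum_congr rfl fun ℓ _ => ?_
      rw [rename_rename]
      rfl
    · exact ⟨fun _ => ⟨0, Nat.succ_pos _⟩,
        isHittingSetGenerator_occurClass_of_le_one _ (by omega)⟩
  exact multilinearSPSHits_of_generator hgen (hsucc r) hKS

/-- **The occur conjunct of FSV Thm. 9 in its SAFE READING (lead-np RULING (33) STEP 2 text, verbatim: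
`∀ D k, ∃ c R, ∀ F [Field F] [Infinite F] n s, (ringChar F = 0 ∨ s ^ R < ringChar F) →
MultilinearSPSHits F n ((⌈log₂ s⌉ + n + 2) ^ c) (occurClass F _ D k s)`), PROVED modulo
`FSV2018_thm48_topFanIn`** — so that, once `FSV2018_thm9_occur` carries this text,
`FSV2018_thm9_occur_of_thm48_topFanIn := this` and the N1 residual of `FSV2018_thm9` is
`{FSV2018_fact19, FSV2018_thm48_topFanIn}` with `FSV2018_thm48`/`FSV2018_cor49` bypassed.
[cite: ForbesShpilkaVolk2018, Thm. 9 and Cor. 49 (seq.) = ToC Thm. 1.10 and Cor. 5.25; AgrawalEtAl2011, §4 (Thm. dDkrPIT)] -/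
theorem FSV2018_thm9_occur_safe_of_thm48_topFanIn (h : FSV2018_thm48_topFanIn) :
    ∀ D k : ℕ, ∃ c R : ℕ, ∀ (F : Type) [Field F] [Infinite F] (n s : ℕ),
      (ringChar F = 0 ∨ s ^ R < ringChar F) →
        MultilinearSPSHits F n ((Nat.clog 2 s + n + 2) ^ c)
          (occurClass F (multilinearMonomials n) D k s) :=
  fun D k => ⟨_, _, multilinearSPSHits_occurClass_of_thm48_topFanIn h D k⟩

end Literature.Computability.AlgebraicComplexity

end
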